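import Literature.Probability.RandomPlanarGeometry.HexSAWRotSurfaceYcLimitAllY
import Literature.Probability.RandomPlanarGeometry.HexSAWArmchairSqrtAsymptotic
import Mathlib.Analysis.MeanInequalities
import Mathlib.Analysis.Convex.Deriv
import HarnessLib

/-!
# Beaton 2014, Proposition 7 in the rotated frame: `μ(y) ≥ max{μ, √y}`, the finite-`n` Hölder inequalities for `C⁺_n(y)`,
# `μ(y') ≤ (y'/y) μ(y)`, and zero surface density below `y†`

Topic `Literature/Probability/RandomPlanarGeometry` (rider on `HexSAWRotSurfaceYcLimitAllY.lean`: the limit `rotSurfaceMu y = lim C⁺_n(y)^{1/n}`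
exists for every `y > 0`; frame twins of a-idea-1 g21's DCS-frame riders `HexSAWSurfaceYcProp5Riders.lean`).  Source: N. R. Beaton, J. Phys.
A 47 (2014) 075003, arXiv:1210.0274v3, §3.1, Proposition 7 (p. 11: "exists and is finite. It is a log-convex, non-decreasing function of
`log y`, and therefore continuous and almost everywhere differentiable. … Moreover, for any `y > 0`, `μ(y) ≥ max{μ, √y}`") and its proof
(p. 14: "The other results are elementary, and follow from a paper of Whittington [W75]. In particular, the lower bound `μ(y) ≥ √y` is
obtained by considering walks which step along the surface"); J. M. Hammersley, G. M. Torrie, S. G. Whittington, J. Phys. A 15 (1982)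
539, §2 (log-convexity by Hölder / Cauchy–Schwarz on the partition functions).

## What is proved (all PROVED; namespace `…SAW.HV`)

* **`sqrt_le_rotSurfaceMu`, `max_le_rotSurfaceMu : max μ √y ≤ μ_rot(y)`** (from the tree's `one_le_armRate_div_sqrt` of
  `HexSAWArmchairSqrtAsymptotic.lean` — the dimer step `(0,0) → (0,1)` is a wall bridge with two surface vertices, `y² ≤ B^w_1(y) ≤ β_rot(y)⁴`);
* `rotSurfaceMu_le_div_mul : μ_rot(y') ≤ (y'/y) μ_rot(y)` (`0 < y ≤ y'`);
* `rotHpCoeff_sqrt_mul_sq_le` (Cauchy–Schwarz on the half-plane sums), `rotSurfaceMu_sqrt_mul_sq_le : μ_rot(√(y₁y₂))² ≤ μ_rot(y₁) μ_rot(y₂)`,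
  `rotHpCoeff_rpow_mul_rpow_le` (Hölder on `C⁺_n`) — the finite-`n` inequalities behind "log-convex in log y" for the LIMIT object
  (the clauses themselves — `convexOn_log_rotSurfaceMu_exp`, `monotoneOn_rotSurfaceMu`, `continuousOn_rotSurfaceMu`,
  `ae_differentiableAt_rotSurfaceMu` — are the tree's `HexSAWArmchairWallRateSqrtMonotone.lean`, door-free, by the Fekete route;
  here the PRINTED route: `rotSurfaceMu_sqrt_mul_sq_le` is midpoint log-convexity of the LIMIT `μ(y)` read off the finite sums);
* the density remark at Beaton's `y_c = y†`, desorbed side: `hasDerivAt_rotSurfaceMu_zero` (`0 < y < y†`), `deriv_rotSurfaceMu_eq_zero`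
  (the adsorbed side — positive one-sided densities for every `y > y†` — is the lane's «ROT-ORDER-PARAMETER» module).
LABEL: CONSOLIDATION (Beaton 2014 Prop. 7: the lower bound `μ(y) ≥ max{μ, √y}`, the finite-`n` Hölder inequalities by the printed
mechanism, and zero density below `y† = y_c` through the door).
EDITIONS: ed.1 867a5a3fe85ea3d5 (custody a-idea-2 g22; proved clauses 2–4 through the door); ed.2 5ca395840d220221 = ed.1 MINUS the five
declarations `rotSurfaceMu_rpow_mul_rpow_le`, `convexOn_log_rotSurfaceMu_exp`, `monotoneOn_rotSurfaceMu`, `continuousOn_rotSurfaceMu`,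
`ae_differentiableAt_rotSurfaceMu` (now in `HexSAWArmchairWallRateSqrtMonotone.lean`, edition 3, with the same names and statements, door-free)
PLUS that import; ed.3 (this) = ed.2 MINUS the two declarations `deriv_rotSurfaceMu_pos`, `rotSurfaceDensity_dichotomy` (the only users of
that import, re-homed in «ROT-ORDER-PARAMETER») and MINUS that import, and MINUS the two lemmas `sq_le_WB_one`, `sqrt_le_armRate` (statement
twins of private lemmas of the landed `HexSAWArmchairSqrtAsymptotic.lean`, whose public `one_le_armRate_div_sqrt` now feeds
`sqrt_le_rotSurfaceMu` — the one proof that changed) PLUS the import of that file; every other remaining declaration byte-identical.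
-/

noncomputable section

open Finset Filter Function
open Literature.Probability.LatticeModels Literature.Probability.Percolation SimpleGraph
open _root_.Topology

namespace Literature.Probability.RandomPlanarGeometry.SAW.HV

open HexBW.Arm

variable {y y₁ y₂ θ : ℝ}

/-! ### `μ(y) ≥ max{μ, √y}` -/

/-- **`√y ≤ μ_rot(y)`.** [cite: Beaton2014RotatedHoneycomb, Proposition 7 (arXiv v3 p. 11: "μ(y) ≥ max{μ, √y}")] -/
theorem sqrt_le_rotSurfaceMu (hy : 0 < y) : Real.sqrt y ≤ rotSurfaceMu y := by
  have h := one_le_armRate_div_sqrt hy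
  rw [le_div_iff₀ (Real.sqrt_pos.2 hy), one_mul] at h
  exact h.trans (armRate_le_rotSurfaceMu y)

/-- **`μ_rot(y) ≥ max{μ, √y}`** — Beaton's Proposition 7, last displayed inequality. [cite: Beaton2014RotatedHoneycomb, Proposition 7 (arXiv v3 p. 11: "Moreover, for any y > 0, μ(y) ≥ max{μ, √y}")] -/
theorem max_le_rotSurfaceMu (hy : 0 < y) : max hexConnectiveConstant (Real.sqrt y) ≤ rotSurfaceMu y :=
  max_le (hexConnectiveConstant_le_rotSurfaceMu y) (sqrt_le_rotSurfaceMu hy)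

/-! ### `μ(y)/y` non-increasing and continuity -/

/-- **`μ_rot(y') ≤ (y'/y) μ_rot(y)` for `0 < y ≤ y'`** (from R4's `C⁺_n(y') ≤ (y'/y)ⁿ C⁺_n(y)`). [cite: Beaton2014RotatedHoneycomb, Proposition 7 (arXiv v3 p. 11); HammersleyTorrieWhittington1982, §2] -/
theorem rotSurfaceMu_le_div_mul (hy : 0 < y) {y' : ℝ} (hyy' : y ≤ y') : rotSurfaceMu y' ≤ y' / y * rotSurfaceMu y := by
  have hq : 0 ≤ y' / y := div_nonneg (hy.le.trans hyy') hy.le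
  refine le_of_tendsto_of_tendsto (tendsto_rotHpCoeff_rpow (hy.trans_le hyy')) ((tendsto_rotHpCoeff_rpow hy).const_mul _) ?_
  filter_upwards [eventually_ne_atTop 0] with n hn0
  calc rotHpCoeff n y' ^ ((n : ℝ)⁻¹) ≤ ((y' / y) ^ n * rotHpCoeff n y) ^ ((n : ℝ)⁻¹) :=
        Real.rpow_le_rpow (rotHpCoeff_nonneg n (hy.le.trans hyy')) (rotHpCoeff_le_pow_mul hy hyy' n) (inv_nonneg.2 (Nat.cast_nonneg n))
    _ = y' / y * rotHpCoeff n y ^ ((n : ℝ)⁻¹) := by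
        rw [Real.mul_rpow (pow_nonneg hq n) (rotHpCoeff_nonneg n hy.le), Real.pow_rpow_inv_natCast hq hn0]

/-! ### Log-convexity in `log y` (Cauchy–Schwarz / Hölder on `C⁺_n`) -/

/-- Cauchy–Schwarz on the fibre: **`C⁺_n(√(y₁y₂))² ≤ C⁺_n(y₁)·C⁺_n(y₂)`.** [cite: HammersleyTorrieWhittington1982, §2; Beaton2014RotatedHoneycomb, Proposition 7 (arXiv v3 p. 11: "log-convex")] -/
theorem rotHpCoeff_sqrt_mul_sq_le (hy₁ : 0 ≤ y₁) (hy₂ : 0 ≤ y₂) (n : ℕ) :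
    rotHpCoeff n (Real.sqrt (y₁ * y₂)) ^ 2 ≤ rotHpCoeff n y₁ * rotHpCoeff n y₂ := by
  have key := Finset.sum_mul_sq_le_sq_mul_sq (rotHpWalks n) (fun l => Real.sqrt y₁ ^ surfCount l) (fun l => Real.sqrt y₂ ^ surfCount l)
  have e : ∀ l : List HV, Real.sqrt (y₁ * y₂) ^ surfCount l = Real.sqrt y₁ ^ surfCount l * Real.sqrt y₂ ^ surfCount l :=
    fun l => by rw [Real.sqrt_mul hy₁, mul_pow]
  have e1 : ∀ l : List HV, (Real.sqrt y₁ ^ surfCount l) ^ 2 = y₁ ^ surfCount l :=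
    fun l => by rw [← pow_mul, mul_comm, pow_mul, Real.sq_sqrt hy₁]
  have e2 : ∀ l : List HV, (Real.sqrt y₂ ^ surfCount l) ^ 2 = y₂ ^ surfCount l :=
    fun l => by rw [← pow_mul, mul_comm, pow_mul, Real.sq_sqrt hy₂]
  simp only [e1, e2] at key
  unfold rotHpCoeff
  simp only [e]
  exact key

/-- **`μ_rot(√(y₁y₂))² ≤ μ_rot(y₁)·μ_rot(y₂)`** (midpoint log-convexity). [cite: Beaton2014RotatedHoneycomb, Proposition 7 (arXiv v3 p. 11: "log-convex"); HammersleyTorrieWhittington1982, §2] -/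
theorem rotSurfaceMu_sqrt_mul_sq_le (hy₁ : 0 < y₁) (hy₂ : 0 < y₂) :
    rotSurfaceMu (Real.sqrt (y₁ * y₂)) ^ 2 ≤ rotSurfaceMu y₁ * rotSurfaceMu y₂ := by
  have hs : 0 < Real.sqrt (y₁ * y₂) := Real.sqrt_pos.2 (mul_pos hy₁ hy₂)
  refine le_of_tendsto_of_tendsto' ((tendsto_rotHpCoeff_rpow hs).pow 2)
    ((tendsto_rotHpCoeff_rpow hy₁).mul (tendsto_rotHpCoeff_rpow hy₂)) fun n => ?_
  have h0 := rotHpCoeff_nonneg n hs.le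
  calc (rotHpCoeff n (Real.sqrt (y₁ * y₂)) ^ ((n : ℝ)⁻¹)) ^ 2 = (rotHpCoeff n (Real.sqrt (y₁ * y₂)) ^ 2) ^ ((n : ℝ)⁻¹) :=
        Real.rpow_pow_comm h0 _ 2
    _ ≤ (rotHpCoeff n y₁ * rotHpCoeff n y₂) ^ ((n : ℝ)⁻¹) :=
        Real.rpow_le_rpow (sq_nonneg _) (rotHpCoeff_sqrt_mul_sq_le hy₁.le hy₂.le n) (inv_nonneg.2 (Nat.cast_nonneg n))
    _ = rotHpCoeff n y₁ ^ ((n : ℝ)⁻¹) * rotHpCoeff n y₂ ^ ((n : ℝ)⁻¹) :=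
        Real.mul_rpow (rotHpCoeff_nonneg n hy₁.le) (rotHpCoeff_nonneg n hy₂.le)

/-- Hölder on the fibre: **`C⁺_n(y₁^θ y₂^{1−θ}) ≤ C⁺_n(y₁)^θ C⁺_n(y₂)^{1−θ}`** (`0 < θ < 1`). [cite: HammersleyTorrieWhittington1982, §2; Beaton2014RotatedHoneycomb, Proposition 7 (arXiv v3 p. 11: "log-convex")] -/
theorem rotHpCoeff_rpow_mul_rpow_le (hy₁ : 0 < y₁) (hy₂ : 0 < y₂) (hθ0 : 0 < θ) (hθ1 : θ < 1) (n : ℕ) :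
    rotHpCoeff n (y₁ ^ θ * y₂ ^ (1 - θ)) ≤ rotHpCoeff n y₁ ^ θ * rotHpCoeff n y₂ ^ (1 - θ) := by
  have hpq : θ⁻¹.HolderConjugate (1 - θ)⁻¹ := Real.HolderConjugate.inv_one_sub_inv hθ0 hθ1
  have h1θ : 0 < 1 - θ := sub_pos.2 hθ1
  unfold rotHpCoeff
  have key := Real.inner_le_Lp_mul_Lq_of_nonneg (rotHpWalks n) hpq
      (f := fun l => (y₁ ^ surfCount l) ^ θ) (g := fun l => (y₂ ^ surfCount l) ^ (1 - θ))
      (fun l _ => by positivity) (fun l _ => by positivity)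
  have hf : ∀ l : List HV, ((y₁ ^ surfCount l) ^ θ) ^ θ⁻¹ = y₁ ^ surfCount l := fun l =>
    Real.rpow_rpow_inv (pow_nonneg hy₁.le _) hθ0.ne'
  have hg : ∀ l : List HV, ((y₂ ^ surfCount l) ^ (1 - θ)) ^ (1 - θ)⁻¹ = y₂ ^ surfCount l := fun l =>
    Real.rpow_rpow_inv (pow_nonneg hy₂.le _) h1θ.ne'
  have hfg : ∀ l : List HV, (y₁ ^ surfCount l) ^ θ * (y₂ ^ surfCount l) ^ (1 - θ) = (y₁ ^ θ * y₂ ^ (1 - θ)) ^ surfCount l := fun l => by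
    rw [mul_pow, Real.rpow_pow_comm hy₁.le, Real.rpow_pow_comm hy₂.le]
  simp only [one_div, inv_inv, hf, hg, hfg] at key
  exact key

/-! ### Zero surface density below `y†` -/

/-- Below `y†` the limit is locally constant (`= μ`): `μ_rot'(y) = 0` for `0 < y < y†`. [cite: Beaton2014RotatedHoneycomb, Proposition 7 (arXiv v3 p. 11: "μ(y) = μ if y ≤ y_c") and Theorem 1 (p. 2)] -/
theorem hasDerivAt_rotSurfaceMu_zero (hy0 : 0 < y) (hy : y < rotYdagger) : HasDerivAt rotSurfaceMu 0 y := by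
  refine (hasDerivAt_const y hexConnectiveConstant).congr_of_eventuallyEq ?_
  filter_upwards [Ioo_mem_nhds hy0 hy] with z hz
  exact (rotSurfaceMu_eq_iff hz.1).2 hz.2.le

/-- `deriv μ_rot y = 0` for `0 < y < y†`. [cite: Beaton2014RotatedHoneycomb, Proposition 7 (arXiv v3 p. 11)] -/
theorem deriv_rotSurfaceMu_eq_zero (hy0 : 0 < y) (hy : y < rotYdagger) : deriv rotSurfaceMu y = 0 :=
  (hasDerivAt_rotSurfaceMu_zero hy0 hy).deriv

end Literature.Probability.RandomPlanarGeometry.SAW.HV
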